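import Literature.Analysis.FluidPDE.ElgindiAngularIdentification
import Literature.Analysis.FluidPDE.ElgindiHkNormLink
import HarnessLib

/-!
# Tools for reading the `𝓗⁴` elliptic a-priori estimate in the tree's `eHkNormSq`
([ElgindiGhoulMasmoudi2021] §1.7, §6 Theorem 3)

Topic `Literature/Analysis/FluidPDE`. Proof file (everything proved, no definitions, no named
facts) on the proof path of the named fact
`Literature.Analysis.FluidPDE.Elgindi.ElgindiGhoulMasmoudi2021_stabilityCore`
(`ElgindiStabilityDecomposition.lean`). [ElgindiGhoulMasmoudi2021] §1.7 (p. 6 of arXiv:1910.14071)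
defines `|f|²_{𝓗ᵏ} = Σ_j‖D_R^jf·w/sin(2θ)^{η/2}‖² + Σ_{i≥1,i+j≤k}‖D_θ^iD_R^jf·W‖²` (the tree's
`eHkNormSq`, a `[0,∞]`-valued functional), while the elliptic estimates of §6 / [Elgindi2021] §7 are
inequalities between real weighted integrals of `∂_θ`-derivatives. This file provides the glue:

* `eHkNormSq_congr_strip`: the functional only sees values on the open strip;
* `sq_hkRadialTerm`, `sq_hkMixedTerm`: the squared terms as `w²·X²·sin(2θ)^{−η|−γ}` on the strip;
* `eL2Sq_le_ofReal_add4` (a term is bounded by real integrals dominating its square) and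
  `ofReal_setIntegral_le_add4` (a real integral is bounded by terms dominating its integrand);
* `aemeasurable_hkMixedTerm_of_continuous`, `aemeasurable_hkRadialTerm_of_continuous`;
* per-order two-sided comparisons `up_one … up_four`, `down_one … down_four` between
  `w²(D_θ^ig)²s^{−γ}` and `w²(∂_θ^ng)²s^{2n−γ}`, `n ≤ i` (from `ElgindiAngularOperatorExpansion.lean`).
-/

noncomputable section

open MeasureTheory Set Real Filter Function Finset
open _root_.Topology
open scoped ENNReal

namespace Literature.Analysis.FluidPDE

namespace Elgindi

/-! ### The functional on the strip -/

/-- `|f|²_{𝓗ᵏ}` only sees the values on the open strip. [folklore] -/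
theorem eHkNormSq_congr_strip (α : ℝ) (k : ℕ) {f g : ℝ → ℝ → ℝ} (h : ∀ p ∈ strip, f p.1 p.2 = g p.1 p.2) :
    eHkNormSq α k f = eHkNormSq α k g := by
  unfold eHkNormSq
  have hr : ∀ j, eL2Sq (hkRadialTerm j f) = eL2Sq (hkRadialTerm j g) := fun j =>
    eL2Sq_congr_strip fun p hp => by simp only [hkRadialTerm]; rw [iterate_Dz_congr h j p hp]
  have hm : ∀ i j, eL2Sq (hkMixedTerm α i j f) = eL2Sq (hkMixedTerm α i j g) := fun i j =>
    eL2Sq_congr_strip fun p hp => by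
      simp only [hkMixedTerm]
      rw [iterate_Dθ_congr (fun q hq => iterate_Dz_congr h j q hq) i p hp]
  simp only [hr, hm]

/-- The squared radial term on the strip: `(D_R^jf·w/s^{η/2})² = w²(D_R^jf)²s^{−η}`. [folklore] -/
theorem sq_hkRadialTerm (j : ℕ) (f : ℝ → ℝ → ℝ) {p : ℝ × ℝ} (hp : p ∈ strip) :
    (hkRadialTerm j f p.1 p.2) ^ 2 = radialWeight p.1 ^ 2 * (Dz^[j] f) p.1 p.2 ^ 2 * Real.sin (2 * p.2) ^ (-eta) := by
  simp only [hkRadialTerm]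
  rw [sq_mul_hWeight hp]
  simp only [wEta]; ring

/-- The squared mixed term on the strip: `(D_θ^iD_R^jf·W)² = w²(D_θ^iD_R^jf)²s^{−γ}`. [folklore] -/
theorem sq_hkMixedTerm (α : ℝ) (i j : ℕ) (f : ℝ → ℝ → ℝ) {p : ℝ × ℝ} (hp : p ∈ strip) :
    (hkMixedTerm α i j f p.1 p.2) ^ 2 = radialWeight p.1 ^ 2 * (Dθ^[i] (Dz^[j] f)) p.1 p.2 ^ 2 * Real.sin (2 * p.2) ^ (-gammaExp α) := by
  simp only [hkMixedTerm]
  rw [sq_mul_totalWeight α hp]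
  simp only [wGam]; ring

/-! ### Measurability of the terms -/

/-- The mixed term of a function with continuous `D_θ^iD_R^j` is a.e.-measurable on the strip. [folklore] -/
theorem aemeasurable_hkMixedTerm_of_continuous (α : ℝ) {i j : ℕ} {f : ℝ → ℝ → ℝ}
    (hc : Continuous (uncurry (Dθ^[i] (Dz^[j] f)))) : AEMeasurable (uncurry (hkMixedTerm α i j f)) (volume.restrict strip) := by
  have e : uncurry (hkMixedTerm α i j f) = fun p : ℝ × ℝ => uncurry (Dθ^[i] (Dz^[j] f)) p *
      (radialWeight p.1 * Real.sin (2 * p.2) ^ (-(gammaExp α / 2))) := by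
    funext p; simp only [uncurry, hkMixedTerm, totalWeight, thetaWeight]
  rw [e]
  refine (hc.measurable.mul ?_).aemeasurable
  unfold radialWeight
  fun_prop

/-- The radial term of a function with continuous `D_R^j` is a.e.-measurable on the strip. [folklore] -/
theorem aemeasurable_hkRadialTerm_of_continuous {j : ℕ} {f : ℝ → ℝ → ℝ}
    (hc : Continuous (uncurry (Dz^[j] f))) : AEMeasurable (uncurry (hkRadialTerm j f)) (volume.restrict strip) := by
  have e : uncurry (hkRadialTerm j f) = fun p : ℝ × ℝ => uncurry (Dz^[j] f) p * (radialWeight p.1 / Real.sin (2 * p.2) ^ (eta / 2)) := by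
    funext p; simp only [uncurry, hkRadialTerm, hWeight]
  rw [e]
  refine (hc.measurable.mul ?_).aemeasurable
  unfold radialWeight
  fun_prop

/-! ### A term against real integrals, and a real integral against terms -/

/-- **A term of the functional is bounded by real integrals dominating its square**:
`g² ≤ c₁H₁ + c₂H₂ + c₃H₃ + c₄H₄` on the strip (all `Hₖ ≥ 0` integrable there, `cₖ ≥ 0`) gives
`eL2Sq g ≤ ofReal (c₁∫H₁ + c₂∫H₂ + c₃∫H₃ + c₄∫H₄)`. [folklore] -/
theorem eL2Sq_le_ofReal_add4 {g : ℝ → ℝ → ℝ} {H₁ H₂ H₃ H₄ : ℝ × ℝ → ℝ} {c₁ c₂ c₃ c₄ : ℝ}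
    (hc₁ : 0 ≤ c₁) (hc₂ : 0 ≤ c₂) (hc₃ : 0 ≤ c₃) (hc₄ : 0 ≤ c₄)
    (h₁ : IntegrableOn H₁ strip) (h₂ : IntegrableOn H₂ strip) (h₃ : IntegrableOn H₃ strip) (h₄ : IntegrableOn H₄ strip)
    (h₁0 : ∀ p ∈ strip, 0 ≤ H₁ p) (h₂0 : ∀ p ∈ strip, 0 ≤ H₂ p) (h₃0 : ∀ p ∈ strip, 0 ≤ H₃ p) (h₄0 : ∀ p ∈ strip, 0 ≤ H₄ p)
    (h : ∀ p ∈ strip, (g p.1 p.2) ^ 2 ≤ c₁ * H₁ p + c₂ * H₂ p + c₃ * H₃ p + c₄ * H₄ p) :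
    eL2Sq g ≤ ENNReal.ofReal (c₁ * (∫ p in strip, H₁ p) + c₂ * (∫ p in strip, H₂ p) + c₃ * (∫ p in strip, H₃ p) + c₄ * ∫ p in strip, H₄ p) := by
  rw [eL2Sq_eq_lintegral_ofReal]
  have hS : IntegrableOn (fun p => c₁ * H₁ p + c₂ * H₂ p + c₃ * H₃ p + c₄ * H₄ p) strip :=
    (((h₁.const_mul _).add (h₂.const_mul _)).add (h₃.const_mul _)).add (h₄.const_mul _)
  have hS0 : 0 ≤ᵐ[volume.restrict strip] fun p => c₁ * H₁ p + c₂ * H₂ p + c₃ * H₃ p + c₄ * H₄ p := by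
    rw [EventuallyLE, ae_restrict_iff' measurableSet_strip]
    exact Filter.Eventually.of_forall fun p hp => by
      have := h₁0 p hp; have := h₂0 p hp; have := h₃0 p hp; have := h₄0 p hp; positivity
  calc ∫⁻ p in strip, ENNReal.ofReal ((g p.1 p.2) ^ 2)
      ≤ ∫⁻ p in strip, ENNReal.ofReal (c₁ * H₁ p + c₂ * H₂ p + c₃ * H₃ p + c₄ * H₄ p) :=
        setLIntegral_mono' measurableSet_strip fun p hp => ENNReal.ofReal_le_ofReal (h p hp)
    _ = ENNReal.ofReal (∫ p in strip, (c₁ * H₁ p + c₂ * H₂ p + c₃ * H₃ p + c₄ * H₄ p)) :=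
        (ofReal_integral_eq_lintegral_ofReal hS hS0).symm
    _ = _ := by
        have k1 : IntegrableOn (fun p => c₁ * H₁ p) strip := h₁.const_mul _
        have k2 : IntegrableOn (fun p => c₂ * H₂ p) strip := h₂.const_mul _
        have k3 : IntegrableOn (fun p => c₃ * H₃ p) strip := h₃.const_mul _
        have k4 : IntegrableOn (fun p => c₄ * H₄ p) strip := h₄.const_mul _
        have k12 : IntegrableOn (fun p => c₁ * H₁ p + c₂ * H₂ p) strip := k1.add k2
        have k123 : IntegrableOn (fun p => c₁ * H₁ p + c₂ * H₂ p + c₃ * H₃ p) strip := k12.add k3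
        rw [integral_add k123 k4, integral_add k12 k3, integral_add k1 k2,
          MeasureTheory.integral_const_mul, MeasureTheory.integral_const_mul, MeasureTheory.integral_const_mul,
          MeasureTheory.integral_const_mul]

/-- **A real integral is bounded by terms of the functional dominating its integrand**:
`H ≤ c₁G₁² + c₂G₂² + c₃G₃² + c₄G₄²` on the strip (`H ≥ 0` integrable, `cₖ ≥ 0`, `Gₖ` a.e.-measurable)
gives `ofReal (∫H) ≤ ofReal c₁·eL2Sq G₁ + … + ofReal c₄·eL2Sq G₄`. [folklore] -/
theorem ofReal_setIntegral_le_add4 {H : ℝ × ℝ → ℝ} (hH : IntegrableOn H strip) (hH0 : ∀ p ∈ strip, 0 ≤ H p)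
    {G₁ G₂ G₃ G₄ : ℝ → ℝ → ℝ} {c₁ c₂ c₃ c₄ : ℝ} (hc₁ : 0 ≤ c₁) (hc₂ : 0 ≤ c₂) (hc₃ : 0 ≤ c₃) (hc₄ : 0 ≤ c₄)
    (m₁ : AEMeasurable (uncurry G₁) (volume.restrict strip)) (m₂ : AEMeasurable (uncurry G₂) (volume.restrict strip))
    (m₃ : AEMeasurable (uncurry G₃) (volume.restrict strip)) (m₄ : AEMeasurable (uncurry G₄) (volume.restrict strip))
    (h : ∀ p ∈ strip, H p ≤ c₁ * (G₁ p.1 p.2) ^ 2 + c₂ * (G₂ p.1 p.2) ^ 2 + c₃ * (G₃ p.1 p.2) ^ 2 + c₄ * (G₄ p.1 p.2) ^ 2) :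
    ENNReal.ofReal (∫ p in strip, H p) ≤ ENNReal.ofReal c₁ * eL2Sq G₁ + ENNReal.ofReal c₂ * eL2Sq G₂ +
      ENNReal.ofReal c₃ * eL2Sq G₃ + ENNReal.ofReal c₄ * eL2Sq G₄ := by
  have hH0' : 0 ≤ᵐ[volume.restrict strip] H := by
    rw [EventuallyLE, ae_restrict_iff' measurableSet_strip]; exact Filter.Eventually.of_forall hH0
  rw [ofReal_integral_eq_lintegral_ofReal hH hH0', eL2Sq_eq_lintegral_ofReal, eL2Sq_eq_lintegral_ofReal,
    eL2Sq_eq_lintegral_ofReal, eL2Sq_eq_lintegral_ofReal]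
  have mk : ∀ {G : ℝ → ℝ → ℝ} (c : ℝ), AEMeasurable (uncurry G) (volume.restrict strip) →
      AEMeasurable (fun p : ℝ × ℝ => ENNReal.ofReal c * ENNReal.ofReal ((G p.1 p.2) ^ 2)) (volume.restrict strip) :=
    fun c m => ((m.pow_const 2).ennreal_ofReal).const_mul _
  calc ∫⁻ p in strip, ENNReal.ofReal (H p)
      ≤ ∫⁻ p in strip, (ENNReal.ofReal c₁ * ENNReal.ofReal ((G₁ p.1 p.2) ^ 2) + ENNReal.ofReal c₂ * ENNReal.ofReal ((G₂ p.1 p.2) ^ 2) +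
          ENNReal.ofReal c₃ * ENNReal.ofReal ((G₃ p.1 p.2) ^ 2) + ENNReal.ofReal c₄ * ENNReal.ofReal ((G₄ p.1 p.2) ^ 2)) := by
        refine setLIntegral_mono' measurableSet_strip fun p hp => ?_
        calc ENNReal.ofReal (H p) ≤ ENNReal.ofReal (c₁ * (G₁ p.1 p.2) ^ 2 + c₂ * (G₂ p.1 p.2) ^ 2 + c₃ * (G₃ p.1 p.2) ^ 2 + c₄ * (G₄ p.1 p.2) ^ 2) :=
              ENNReal.ofReal_le_ofReal (h p hp)
          _ = _ := by
              rw [ENNReal.ofReal_add (by positivity) (by positivity), ENNReal.ofReal_add (by positivity) (by positivity),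
                ENNReal.ofReal_add (by positivity) (by positivity), ENNReal.ofReal_mul hc₁, ENNReal.ofReal_mul hc₂,
                ENNReal.ofReal_mul hc₃, ENNReal.ofReal_mul hc₄]
    _ = _ := by
        have a1 := mk c₁ m₁
        have a12 : AEMeasurable (fun p : ℝ × ℝ => ENNReal.ofReal c₁ * ENNReal.ofReal ((G₁ p.1 p.2) ^ 2) +
            ENNReal.ofReal c₂ * ENNReal.ofReal ((G₂ p.1 p.2) ^ 2)) (volume.restrict strip) := a1.add (mk c₂ m₂)
        have a123 : AEMeasurable (fun p : ℝ × ℝ => ENNReal.ofReal c₁ * ENNReal.ofReal ((G₁ p.1 p.2) ^ 2) +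
            ENNReal.ofReal c₂ * ENNReal.ofReal ((G₂ p.1 p.2) ^ 2) + ENNReal.ofReal c₃ * ENNReal.ofReal ((G₃ p.1 p.2) ^ 2)) (volume.restrict strip) :=
          a12.add (mk c₃ m₃)
        have p1 : AEMeasurable (fun p : ℝ × ℝ => ENNReal.ofReal ((G₁ p.1 p.2) ^ 2)) (volume.restrict strip) := (m₁.pow_const 2).ennreal_ofReal
        have p2 : AEMeasurable (fun p : ℝ × ℝ => ENNReal.ofReal ((G₂ p.1 p.2) ^ 2)) (volume.restrict strip) := (m₂.pow_const 2).ennreal_ofReal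
        have p3 : AEMeasurable (fun p : ℝ × ℝ => ENNReal.ofReal ((G₃ p.1 p.2) ^ 2)) (volume.restrict strip) := (m₃.pow_const 2).ennreal_ofReal
        have p4 : AEMeasurable (fun p : ℝ × ℝ => ENNReal.ofReal ((G₄ p.1 p.2) ^ 2)) (volume.restrict strip) := (m₄.pow_const 2).ennreal_ofReal
        rw [lintegral_add_left' a123, lintegral_add_left' a12, lintegral_add_left' a1, lintegral_const_mul'' _ p1,
          lintegral_const_mul'' _ p2, lintegral_const_mul'' _ p3, lintegral_const_mul'' _ p4]

/-! ### `D_θ^i` versus `∂_θ^n`, `n ≤ i`, with the weights of the functional -/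

section updown

variable {g : ℝ → ℝ → ℝ} (hg : ContDiff ℝ 4 (uncurry g)) (γ : ℝ) {p : ℝ × ℝ} (hp : p ∈ strip)
include hg hp

/-- Common preparations: nonnegativity of the singular weight, the slice, rpow bookkeeping. [folklore] -/
private theorem prep :
    (0 ≤ Real.sin (2 * p.2) ^ (-γ)) ∧ ContDiff ℝ 4 (fun θ' => g p.1 θ') ∧
    (Real.sin (2 * p.2) ^ 2 * Real.sin (2 * p.2) ^ (-γ) = Real.sin (2 * p.2) ^ (2 - γ)) ∧
    (Real.sin (2 * p.2) ^ 4 * Real.sin (2 * p.2) ^ (-γ) = Real.sin (2 * p.2) ^ (4 - γ)) ∧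
    (Real.sin (2 * p.2) ^ 6 * Real.sin (2 * p.2) ^ (-γ) = Real.sin (2 * p.2) ^ (6 - γ)) ∧
    (Real.sin (2 * p.2) ^ 8 * Real.sin (2 * p.2) ^ (-γ) = Real.sin (2 * p.2) ^ (8 - γ)) := by
  refine ⟨Real.rpow_nonneg (Real.sin_pos_of_pos_of_lt_pi (by linarith [hp.2.1]) (by linarith [hp.2.2])).le _,
    contDiff_slice_θ hg p.1, ?_, ?_, ?_, ?_⟩
  · have := sin_pow_mul_rpow_neg hp 1 γ; norm_num at this; exact this
  · have := sin_pow_mul_rpow_neg hp 2 γ; norm_num at this; exact this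
  · have := sin_pow_mul_rpow_neg hp 3 γ; norm_num at this; exact this
  · have := sin_pow_mul_rpow_neg hp 4 γ; norm_num at this; exact this

/-- (up, `i = 1`) `w²(D_θg)²s^{−γ} = w²(∂_θg)²s^{2−γ}` (as an inequality). [folklore] -/
theorem up_one : radialWeight p.1 ^ 2 * (Dθ^[1] g) p.1 p.2 ^ 2 * Real.sin (2 * p.2) ^ (-γ) ≤
    1 * (radialWeight p.1 ^ 2 * dθ g p.1 p.2 ^ 2 * Real.sin (2 * p.2) ^ (2 - γ)) := by
  obtain ⟨hρ, hu, e1, -, -, -⟩ := prep hg γ hp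
  rw [iterate_Dθ_apply, show dθ g p.1 p.2 = iteratedDeriv 1 (fun θ' => g p.1 θ') p.2 by
    rw [← iterate_dθ_apply 1 g p.1 p.2]; rfl, ← e1, sq_iterate_Dθ₁_one]
  nlinarith [sq_nonneg (radialWeight p.1)]

/-- (up, `i = 2`) `w²(D_θ²g)²s^{−γ} ≤ 8w²(∂g)²s^{2−γ} + 2w²(∂²g)²s^{4−γ}`. [folklore] -/
theorem up_two : radialWeight p.1 ^ 2 * (Dθ^[2] g) p.1 p.2 ^ 2 * Real.sin (2 * p.2) ^ (-γ) ≤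
    8 * (radialWeight p.1 ^ 2 * dθ g p.1 p.2 ^ 2 * Real.sin (2 * p.2) ^ (2 - γ)) +
    2 * (radialWeight p.1 ^ 2 * dθ (dθ g) p.1 p.2 ^ 2 * Real.sin (2 * p.2) ^ (4 - γ)) := by
  obtain ⟨hρ, hu, e1, e2, -, -⟩ := prep hg γ hp
  rw [iterate_Dθ_apply, show dθ g p.1 p.2 = iteratedDeriv 1 (fun θ' => g p.1 θ') p.2 by
    rw [← iterate_dθ_apply 1 g p.1 p.2]; rfl, show dθ (dθ g) p.1 p.2 = iteratedDeriv 2 (fun θ' => g p.1 θ') p.2 by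
    rw [← iterate_dθ_apply 2 g p.1 p.2]; rfl, ← e1, ← e2]
  have h := mul_le_mul_of_nonneg_left (mul_le_mul_of_nonneg_right (sq_iterate_Dθ₁_two_le hu p.2) hρ) (sq_nonneg (radialWeight p.1))
  nlinarith [h]

/-- (up, `i = 3`) `w²(D_θ³g)²s^{−γ} ≤ 48w²(∂g)²s^{2−γ} + 108w²(∂²g)²s^{4−γ} + 3w²(∂³g)²s^{6−γ}`. [folklore] -/
theorem up_three : radialWeight p.1 ^ 2 * (Dθ^[3] g) p.1 p.2 ^ 2 * Real.sin (2 * p.2) ^ (-γ) ≤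
    48 * (radialWeight p.1 ^ 2 * dθ g p.1 p.2 ^ 2 * Real.sin (2 * p.2) ^ (2 - γ)) +
    108 * (radialWeight p.1 ^ 2 * dθ (dθ g) p.1 p.2 ^ 2 * Real.sin (2 * p.2) ^ (4 - γ)) +
    3 * (radialWeight p.1 ^ 2 * (dθ^[3] g) p.1 p.2 ^ 2 * Real.sin (2 * p.2) ^ (6 - γ)) := by
  obtain ⟨hρ, hu, e1, e2, e3, -⟩ := prep hg γ hp
  rw [iterate_Dθ_apply, show dθ g p.1 p.2 = iteratedDeriv 1 (fun θ' => g p.1 θ') p.2 by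
    rw [← iterate_dθ_apply 1 g p.1 p.2]; rfl, show dθ (dθ g) p.1 p.2 = iteratedDeriv 2 (fun θ' => g p.1 θ') p.2 by
    rw [← iterate_dθ_apply 2 g p.1 p.2]; rfl, iterate_dθ_apply 3, ← e1, ← e2, ← e3]
  have h := mul_le_mul_of_nonneg_left (mul_le_mul_of_nonneg_right (sq_iterate_Dθ₁_three_le hu p.2) hρ) (sq_nonneg (radialWeight p.1))
  nlinarith [h]

/-- (up, `i = 4`) `w²(D_θ⁴g)²s^{−γ} ≤ 6400w²(∂g)²s^{2−γ} + 3136w²(∂²g)²s^{4−γ} + 576w²(∂³g)²s^{6−γ} + 4w²(∂⁴g)²s^{8−γ}`. [folklore] -/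
theorem up_four : radialWeight p.1 ^ 2 * (Dθ^[4] g) p.1 p.2 ^ 2 * Real.sin (2 * p.2) ^ (-γ) ≤
    6400 * (radialWeight p.1 ^ 2 * dθ g p.1 p.2 ^ 2 * Real.sin (2 * p.2) ^ (2 - γ)) +
    3136 * (radialWeight p.1 ^ 2 * dθ (dθ g) p.1 p.2 ^ 2 * Real.sin (2 * p.2) ^ (4 - γ)) +
    576 * (radialWeight p.1 ^ 2 * (dθ^[3] g) p.1 p.2 ^ 2 * Real.sin (2 * p.2) ^ (6 - γ)) +
    4 * (radialWeight p.1 ^ 2 * (dθ^[4] g) p.1 p.2 ^ 2 * Real.sin (2 * p.2) ^ (8 - γ)) := by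
  obtain ⟨hρ, hu, e1, e2, e3, e4⟩ := prep hg γ hp
  rw [iterate_Dθ_apply, show dθ g p.1 p.2 = iteratedDeriv 1 (fun θ' => g p.1 θ') p.2 by
    rw [← iterate_dθ_apply 1 g p.1 p.2]; rfl, show dθ (dθ g) p.1 p.2 = iteratedDeriv 2 (fun θ' => g p.1 θ') p.2 by
    rw [← iterate_dθ_apply 2 g p.1 p.2]; rfl, iterate_dθ_apply 3, iterate_dθ_apply 4, ← e1, ← e2, ← e3, ← e4]
  have h := mul_le_mul_of_nonneg_left (mul_le_mul_of_nonneg_right (sq_iterate_Dθ₁_four_le hu p.2) hρ) (sq_nonneg (radialWeight p.1))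
  nlinarith [h]

/-- (down, `i = 1`) `w²(∂g)²s^{2−γ} ≤ w²(D_θg)²s^{−γ}`. [folklore] -/
theorem down_one : radialWeight p.1 ^ 2 * dθ g p.1 p.2 ^ 2 * Real.sin (2 * p.2) ^ (2 - γ) ≤
    1 * (radialWeight p.1 ^ 2 * (Dθ^[1] g) p.1 p.2 ^ 2 * Real.sin (2 * p.2) ^ (-γ)) := by
  obtain ⟨hρ, hu, e1, -, -, -⟩ := prep hg γ hp
  rw [iterate_Dθ_apply, show dθ g p.1 p.2 = iteratedDeriv 1 (fun θ' => g p.1 θ') p.2 by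
    rw [← iterate_dθ_apply 1 g p.1 p.2]; rfl, ← e1, sq_iterate_Dθ₁_one]
  nlinarith [sq_nonneg (radialWeight p.1)]

/-- (down, `i = 2`) `w²(∂²g)²s^{4−γ} ≤ 2w²(D_θ²g)²s^{−γ} + 8w²(D_θg)²s^{−γ}`. [folklore] -/
theorem down_two : radialWeight p.1 ^ 2 * dθ (dθ g) p.1 p.2 ^ 2 * Real.sin (2 * p.2) ^ (4 - γ) ≤
    8 * (radialWeight p.1 ^ 2 * (Dθ^[1] g) p.1 p.2 ^ 2 * Real.sin (2 * p.2) ^ (-γ)) +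
    2 * (radialWeight p.1 ^ 2 * (Dθ^[2] g) p.1 p.2 ^ 2 * Real.sin (2 * p.2) ^ (-γ)) := by
  obtain ⟨hρ, hu, e1, e2, -, -⟩ := prep hg γ hp
  rw [iterate_Dθ_apply 1, iterate_Dθ_apply 2, show dθ (dθ g) p.1 p.2 = iteratedDeriv 2 (fun θ' => g p.1 θ') p.2 by
    rw [← iterate_dθ_apply 2 g p.1 p.2]; rfl, ← e2]
  have q1 := sq_iterate_Dθ₁_one (fun θ' => g p.1 θ') p.2
  have h := sq_sin_pow_mul_iteratedDeriv_two_le hu p.2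
  rw [← q1] at h
  have h' := mul_le_mul_of_nonneg_left (mul_le_mul_of_nonneg_right h hρ) (sq_nonneg (radialWeight p.1))
  nlinarith [h']

/-- (down, `i = 3`) `w²(∂³g)²s^{6−γ} ≤ 912w²(D_θg)²s^{−γ} + 216w²(D_θ²g)²s^{−γ} + 3w²(D_θ³g)²s^{−γ}`. [folklore] -/
theorem down_three : radialWeight p.1 ^ 2 * (dθ^[3] g) p.1 p.2 ^ 2 * Real.sin (2 * p.2) ^ (6 - γ) ≤
    912 * (radialWeight p.1 ^ 2 * (Dθ^[1] g) p.1 p.2 ^ 2 * Real.sin (2 * p.2) ^ (-γ)) +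
    216 * (radialWeight p.1 ^ 2 * (Dθ^[2] g) p.1 p.2 ^ 2 * Real.sin (2 * p.2) ^ (-γ)) +
    3 * (radialWeight p.1 ^ 2 * (Dθ^[3] g) p.1 p.2 ^ 2 * Real.sin (2 * p.2) ^ (-γ)) := by
  obtain ⟨hρ, hu, e1, e2, e3, -⟩ := prep hg γ hp
  rw [iterate_Dθ_apply 1, iterate_Dθ_apply 2, iterate_Dθ_apply 3, iterate_dθ_apply 3, ← e3]
  set u : ℝ → ℝ := fun θ' => g p.1 θ'
  have q1 : (Dθ₁^[1] u) p.2 ^ 2 = Real.sin (2 * p.2) ^ 2 * iteratedDeriv 1 u p.2 ^ 2 := sq_iterate_Dθ₁_one u p.2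
  have q2 := sq_sin_pow_mul_iteratedDeriv_two_le hu p.2
  have q3 := sq_sin_pow_mul_iteratedDeriv_three_le hu p.2
  have c3 : Real.sin (2 * p.2) ^ 6 * iteratedDeriv 3 u p.2 ^ 2 ≤ 3 * (Dθ₁^[3] u) p.2 ^ 2 + 216 * (Dθ₁^[2] u) p.2 ^ 2 + 912 * (Dθ₁^[1] u) p.2 ^ 2 := by
    rw [q1]; nlinarith [q2, q3]
  have h' := mul_le_mul_of_nonneg_left (mul_le_mul_of_nonneg_right c3 hρ) (sq_nonneg (radialWeight p.1))
  nlinarith [h']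

/-- (down, `i = 4`) `w²(∂⁴g)²s^{8−γ} ≤ 556800w²(D_θg)²s^{−γ} + 130688w²(D_θ²g)²s^{−γ} + 1728w²(D_θ³g)²s^{−γ} + 4w²(D_θ⁴g)²s^{−γ}`. [folklore] -/
theorem down_four : radialWeight p.1 ^ 2 * (dθ^[4] g) p.1 p.2 ^ 2 * Real.sin (2 * p.2) ^ (8 - γ) ≤
    556800 * (radialWeight p.1 ^ 2 * (Dθ^[1] g) p.1 p.2 ^ 2 * Real.sin (2 * p.2) ^ (-γ)) +
    130688 * (radialWeight p.1 ^ 2 * (Dθ^[2] g) p.1 p.2 ^ 2 * Real.sin (2 * p.2) ^ (-γ)) +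
    1728 * (radialWeight p.1 ^ 2 * (Dθ^[3] g) p.1 p.2 ^ 2 * Real.sin (2 * p.2) ^ (-γ)) +
    4 * (radialWeight p.1 ^ 2 * (Dθ^[4] g) p.1 p.2 ^ 2 * Real.sin (2 * p.2) ^ (-γ)) := by
  obtain ⟨hρ, hu, e1, e2, e3, e4⟩ := prep hg γ hp
  rw [iterate_Dθ_apply 1, iterate_Dθ_apply 2, iterate_Dθ_apply 3, iterate_Dθ_apply 4, iterate_dθ_apply 4, ← e4]
  set u : ℝ → ℝ := fun θ' => g p.1 θ'
  have q1 : (Dθ₁^[1] u) p.2 ^ 2 = Real.sin (2 * p.2) ^ 2 * iteratedDeriv 1 u p.2 ^ 2 := sq_iterate_Dθ₁_one u p.2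
  have q2 := sq_sin_pow_mul_iteratedDeriv_two_le hu p.2
  have q3 := sq_sin_pow_mul_iteratedDeriv_three_le hu p.2
  have q4 := sq_sin_pow_mul_iteratedDeriv_four_le hu p.2
  have c2 : Real.sin (2 * p.2) ^ 4 * iteratedDeriv 2 u p.2 ^ 2 ≤ 2 * (Dθ₁^[2] u) p.2 ^ 2 + 8 * (Dθ₁^[1] u) p.2 ^ 2 := by rw [q1]; linarith
  have c3 : Real.sin (2 * p.2) ^ 6 * iteratedDeriv 3 u p.2 ^ 2 ≤ 3 * (Dθ₁^[3] u) p.2 ^ 2 + 216 * (Dθ₁^[2] u) p.2 ^ 2 + 912 * (Dθ₁^[1] u) p.2 ^ 2 := by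
    rw [q1]; nlinarith [c2]
  have c4 : Real.sin (2 * p.2) ^ 8 * iteratedDeriv 4 u p.2 ^ 2 ≤ 4 * (Dθ₁^[4] u) p.2 ^ 2 + 1728 * (Dθ₁^[3] u) p.2 ^ 2 +
      130688 * (Dθ₁^[2] u) p.2 ^ 2 + 556800 * (Dθ₁^[1] u) p.2 ^ 2 := by
    rw [q1]; nlinarith [c2, c3]
  have h' := mul_le_mul_of_nonneg_left (mul_le_mul_of_nonneg_right c4 hρ) (sq_nonneg (radialWeight p.1))
  nlinarith [h']

end updown

end Elgindi

end Literature.Analysis.FluidPDE
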